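import Mathlib.Algebra.Colimit.Ring
import Mathlib.RingTheory.Localization.FractionRing
import Mathlib.Order.Directed
import HarnessLib

/-!
# [OURS · L0 W4.1] K3ᴳ (F1): the SEQUENTIAL DIRECT LIMIT of a tower of domains `T 0 → T 1 → T 2 → ⋯` along injective maps
# (chain W4.1 `FrobeniusClosingSteer`, crux stmt-ResolutionOfSingularities-16345; K3ᴳ = `K3GTarget.horizonBaseChange`, res-L0-w41-stub-2 signature
# `L/res-L0-w41-stub-2/K3G/K3G_target_signature.lean` 8151858124874f54; `--supports … --as helper`)

HONEST FRAMING. OURS infrastructure (HIRONAKA-L librarian res-D-lib-1 gen 8), Mathlib-only. The 4-level window of K3-a (`…EtaleWindowLift`) reads its four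
étale residue enlargements `T₀ → T₁ → T₂ → T₃` inside `Frac T₃`; an ℕ-indexed chain has no top level, so K3ᴳ reads the tower `T m := (S m[X]/(P))_𝔫ₘ` inside
the fraction field of its SEQUENTIAL DIRECT LIMIT. This file: for `T : ℕ → Type` (commutative rings) and `g m : T m →+* T (m+1)`,
* `towerMap g h : T n →+* T m` (`n ≤ m`, `Nat.leRec`), `towerMap_self/_succ/_one/_comp`, `directedSystem`, `towerMap_injective`;
* `Limit g := Ring.DirectLimit T (towerMap g)`, `of g m : T m →+* Limit g`, `of_succ` (`of (m+1) ∘ g m = of m`), `of_towerMap`, `exists_of`,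
  `of_injective` (injective `g`), `nontrivial_limit`, **`isDomain_limit`** (domains + injective `g` ⟹ the limit is a domain).
Nothing here is a statement of H. Hironaka's manuscript [Hironaka2017]. AI-written; AI review is weaker than expert review. [folklore]
-/

set_option linter.dupNamespace false

noncomputable section

namespace Summit.ResolutionOfSingularities.ResolutionOfSingularities.Theorems.SwitchingDichotomy.SeqLimit

variable {T : ℕ → Type} [∀ m, CommRing (T m)] (g : ∀ m, T m →+* T (m + 1))

/-! ## Transition maps -/

/-- The transition map `T n → T m` (`n ≤ m`) of the tower: the composite `g (m-1) ∘ ⋯ ∘ g n` (`Nat.leRec`). [invented: ours] -/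
def towerMap {n m : ℕ} (h : n ≤ m) : T n →+* T m :=
  Nat.leRec (motive := fun m _ => T n →+* T m) (RingHom.id (T n)) (fun m _ φ => (g m).comp φ) h

/-- `T n → T n` is the identity. [folklore] -/
theorem towerMap_self (n : ℕ) : towerMap g (Nat.le_refl n) = RingHom.id (T n) :=
  Nat.leRec_self _ _

/-- `T n → T (m+1)` is `g m ∘ (T n → T m)`. [folklore] -/
theorem towerMap_succ {n m : ℕ} (h : n ≤ m) (h' : n ≤ m + 1) : towerMap g h' = (g m).comp (towerMap g h) :=
  Nat.leRec_succ _ _ h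

/-- `T n → T (n+1)` is `g n`. [folklore] -/
theorem towerMap_one (n : ℕ) : towerMap g (Nat.le_succ n) = g n := by
  rw [towerMap_succ g (Nat.le_refl n), towerMap_self, RingHom.comp_id]

/-- Transitivity of the transition maps. [folklore] -/
theorem towerMap_comp {n m l : ℕ} (h₁ : n ≤ m) (h₂ : m ≤ l) (h₃ : n ≤ l) :
    (towerMap g h₂).comp (towerMap g h₁) = towerMap g h₃ := by
  induction l, h₂ using Nat.le_induction with
  | base => rw [towerMap_self, RingHom.id_comp]
  | succ l h₂ ih =>
    rw [towerMap_succ g h₂, towerMap_succ g (h₁.trans h₂) h₃, ← ih (h₁.trans h₂), RingHom.comp_assoc]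

/-- Transitivity, applied form. [folklore] -/
theorem towerMap_towerMap {n m l : ℕ} (h₁ : n ≤ m) (h₂ : m ≤ l) (x : T n) :
    towerMap g h₂ (towerMap g h₁ x) = towerMap g (h₁.trans h₂) x := by
  rw [← RingHom.comp_apply, towerMap_comp g h₁ h₂ (h₁.trans h₂)]

/-- The transition maps form a directed system. [folklore] -/
theorem directedSystem : DirectedSystem T (fun _ _ h => towerMap g h) where
  map_self := fun i x => by
    change towerMap g (Nat.le_refl i) x = x
    rw [towerMap_self, RingHom.id_apply]
  map_map := fun _ _ _ h₁ h₂ x => towerMap_towerMap g h₁ h₂ x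

/-- Injective steps give injective transition maps. [folklore] -/
theorem towerMap_injective (hg : ∀ m, Function.Injective (g m)) {n m : ℕ} (h : n ≤ m) :
    Function.Injective (towerMap g h) := by
  induction m, h using Nat.le_induction with
  | base => rw [towerMap_self]; exact fun _ _ h => h
  | succ m h ih => rw [towerMap_succ g h]; exact (hg m).comp ih

/-! ## The direct limit -/

/-- The sequential direct limit `lim T m` of the tower. [invented: ours] -/
abbrev Limit : Type := Ring.DirectLimit T (fun _ _ h => towerMap g h)

/-- The canonical map `T m → lim T`. [invented: ours] -/
abbrev of (m : ℕ) : T m →+* Limit g := Ring.DirectLimit.of T (fun _ _ h => towerMap g h) m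

/-- Compatibility of the canonical maps with the transition maps. [folklore] -/
theorem of_towerMap {n m : ℕ} (h : n ≤ m) (x : T n) : of g m (towerMap g h x) = of g n x :=
  Ring.DirectLimit.of_f (G := T) (f := fun _ _ h => towerMap g h) h x

/-- Compatibility of the canonical maps with the steps: `of (m+1) (g m x) = of m x`. [folklore] -/
theorem of_succ (m : ℕ) (x : T m) : of g (m + 1) (g m x) = of g m x := by
  rw [← towerMap_one g m]
  exact of_towerMap g (Nat.le_succ m) x

/-- The same as ring maps: `of (m+1) ∘ g m = of m`. [folklore] -/
theorem of_comp_succ (m : ℕ) : (of g (m + 1)).comp (g m) = of g m :=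
  RingHom.ext (of_succ g m)

/-- Every element of the limit comes from some level. [folklore] -/
theorem exists_of (z : Limit g) : ∃ m x, of g m x = z :=
  Ring.DirectLimit.exists_of z

/-- Two levels can be pushed to a common one. [folklore] -/
theorem exists_of₂ (z w : Limit g) : ∃ m x y, of g m x = z ∧ of g m y = w := by
  obtain ⟨i, x, rfl⟩ := exists_of g z
  obtain ⟨j, y, rfl⟩ := exists_of g w
  refine ⟨max i j, towerMap g (le_max_left i j) x, towerMap g (le_max_right i j) y, ?_, ?_⟩
  · exact of_towerMap g _ x
  · exact of_towerMap g _ y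

/-- Injective steps give injective canonical maps `T m → lim T`. [folklore] -/
theorem of_injective (hg : ∀ m, Function.Injective (g m)) (m : ℕ) : Function.Injective (of g m) := by
  haveI := directedSystem g
  exact Ring.DirectLimit.of_injective (G := T) (fun _ _ h => towerMap g h) (fun _ _ h => towerMap_injective g hg h) m

/-- The limit of nontrivial rings along injective steps is nontrivial. [folklore] -/
theorem nontrivial_limit [Nontrivial (T 0)] (hg : ∀ m, Function.Injective (g m)) : Nontrivial (Limit g) := by
  refine ⟨⟨of g 0 0, of g 0 1, fun h => ?_⟩⟩
  exact zero_ne_one (of_injective g hg 0 h)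

/-- No zero divisors in the limit of domains along injective maps. [folklore] -/
theorem noZeroDivisors_limit [∀ m, IsDomain (T m)] (hg : ∀ m, Function.Injective (g m)) : NoZeroDivisors (Limit g) := by
  refine ⟨fun {a b} h => ?_⟩
  obtain ⟨m, x, y, rfl, rfl⟩ := exists_of₂ g a b
  rw [← map_mul] at h
  have hxy : x * y = 0 := of_injective g hg m (by rw [h, map_zero])
  rcases mul_eq_zero.mp hxy with hx | hy
  · left; rw [hx, map_zero]
  · right; rw [hy, map_zero]

/-- **The sequential direct limit of DOMAINS along injective maps is a domain.** [folklore] -/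
theorem isDomain_limit [∀ m, IsDomain (T m)] (hg : ∀ m, Function.Injective (g m)) : IsDomain (Limit g) := by
  haveI := nontrivial_limit g hg
  haveI := noZeroDivisors_limit g hg
  exact NoZeroDivisors.to_isDomain _

end Summit.ResolutionOfSingularities.ResolutionOfSingularities.Theorems.SwitchingDichotomy.SeqLimit

end
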